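import Summits.BirchSwinnertonDyer.BirchSwinnertonDyer.Theorems.AdditiveKolyvaginRoadLevelKolyvaginSystemsAdditivePoitouTateFree
import HarnessLib

/-!
# Route `AdditiveKolyvaginRoad`, crux r2 `KolyvaginPrimitiveAdditive` (item stmt-BirchSwinnertonDyer-21400, KPA′):
# REGISTERED STUB LOC `stub_kolyvaginLocalPackageAdditive` of line `birth` (skeleton v10, sha16 7e88b0632f34f05f) — LANDED BY NAME, unconditionally
# (cell `pub/bsd-wall`, width seat `bsd-wall-akr-p2x-w3` g10; `--supports stmt-BirchSwinnertonDyer-21400`, stub credit; pointer of akr-p2x-w4 g3)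

WHY. The registry of crux r2 KPA′ (stmt-BirchSwinnertonDyer-21400) is skeleton `birth` v10 with four stubs {P, J2, KS, LOC}. LOC — W. Zhang's
local–global package at the places of `K` (`KolyvaginLocalPackageP`, `Theorems/AdditiveKolyvaginRoadLocalPackage.lean`) — is E-side and a THEOREM of
the tree since the Poitou–Tate fact for Selmer structures became the kernel-checked
`SchneiderFreeAdditiveX3.PoitouTateReduction.poitouTate_selmerStructure_duality_holds` (cell bsd-schneider, p624636):
`AdditiveKoly.nonempty_kolyvaginLocalPackageP` (akr-p2x-w4 g2, `…LevelKolyvaginSystemsAdditivePoitouTateFree.lean` §5, p635192; = akr-p1's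
`kolyvaginLocalPackageP_of_poitouTate` at that theorem). That theorem displays two instance binders the registered text does not carry —
compactness of the local absolute Galois groups and finiteness of `E[p](K̄)` —; both are supplied here by the tree's standard recipe
(`absoluteGaloisGroup_compactSpace`, `finite_geomTorsion_of_neZero`), so the registered signature is met VERBATIM. With J2 (sibling file
`…StubTwoPrimeJumpAdditive.lean`) the registry of 21400 then reads {P (Gross–Zagier–Kolyvagin ∕ Cassels–Tate shaped), KS (= crux KS′
stmt-BirchSwinnertonDyer-21396)}: the deadlock of record 21396 ⇄ 21400 is exactly the research residual and nothing else.

WHAT. `…Cruxes.KolyvaginPrimitiveAdditive.Birth.stub_kolyvaginLocalPackageAdditive` — at every ♯ additive frame, for `c ≠ 1` and the `ZMod p`-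
structures of `H¹(K, E[p])` and of the `H¹(K_v, E[p])`: `Nonempty (KolyvaginLocalPackageP W K p ι c)`. Proof: `nonempty_kolyvaginLocalPackageP`
(only `K` imaginary quadratic, `p ≠ 2` (from `5 ≤ p`), `d_K < −4`, `ρ̄_{E,p}` onto, `c ≠ 1` are used; the other frame binders are idle, kept because
the registered text has them).

HONEST FRAMING: one theorem, no definition, no named fact, no `sorry`; standard axioms. It closes STUB LOC of 21400's registry by name and nothing
else; crux r2 KPA′ and crux KS′ stay OPEN (research residual, in print only for `p ∤ N`). BSD is not proved by this.

References: [cite: WZhang2014, §8.1, Lemma 8.1, Lemma 8.2, Prop. 5.4] [cite: MilneADT2006, Ch. I, Cor. 2.3, Thm. 4.10 (b)] [cite: PoonenRains2012, Prop. 4.10]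
[cite: GrossLMS1991, Prop. 8.1, Prop. 9.6].
-/

-- single-conjunct summit: `Summit.BirchSwinnertonDyer.BirchSwinnertonDyer.…` repeats the name by design
set_option linter.dupNamespace false

noncomputable section

open scoped Classical

namespace Summit.BirchSwinnertonDyer.BirchSwinnertonDyer.Cruxes.KolyvaginPrimitiveAdditive.Birth

open WeierstrassCurve NumberField IsDedekindDomain Field Literature.NumberTheory.EllipticCurves
  Literature.NumberTheory.EllipticCurves.ModularForms
  Literature.NumberTheory.EllipticCurves.Rank1Residual
  Literature.NumberTheory.GaloisRepresentations
  Literature.NumberTheory.GaloisCohomology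
  Summit.BirchSwinnertonDyer.Rank1Residual
  Summit.BirchSwinnertonDyer.BirchSwinnertonDyer.Theorems.AdditiveKoly Module

/-- **STUB LOC of crux r2's line `birth` (v10), by name — W. Zhang's local–global package at the places of `K`, unconditionally.** At every ♯
additive frame, for `c ≠ 1` and the `ZMod p`-structures of `H¹(K, E[p])` and of the `H¹(K_v, E[p])`, there is a `KolyvaginLocalPackageP W K p ι c`
(`ZMod p`-bilinear local forms with Poitou–Tate reciprocity for the totally complex `K`, isotropy of E's Kummer ∕ the toric ∕ the transverse
conditions, (Perf), (Line), (Supply)). = `AdditiveKoly.nonempty_kolyvaginLocalPackageP` (p635192, at the Poitou–Tate theorem p624636), its two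
extra instance binders (compact local Galois groups, `E[p](K̄)` finite) discharged in the proof; registered signature verbatim.
[cite: WZhang2014, §8.1, Lemma 8.1, Lemma 8.2, Prop. 5.4] [cite: MilneADT2006, Ch. I, Cor. 2.3, Thm. 4.10 (b)] [cite: PoonenRains2012, Prop. 4.10]
[cite: GrossLMS1991, Prop. 8.1, Prop. 9.6] -/
theorem stub_kolyvaginLocalPackageAdditive :
  ∀ (W : WeierstrassCurve ℚ) [W.IsElliptic] [W.IsGloballyMinimal] [NeZero (W.conductorNorm ℤ)]
    (p : ℕ) [Fact p.Prime] (K : Type) [Field K] [NumberField K]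
    (Dt : ModularParametrizationData W (W.conductorNorm ℤ)) (β : ℤ) (ι : K →+* ℂ),
    5 ≤ p → Addv W p → W.HasSurjectiveModNGaloisRep p →
    (∀ (ℓ : ℕ) [Fact ℓ.Prime], W.HasMultiplicativeReductionAtPrime ℓ →
      ¬ p ∣ padicValInt ℓ W.minimalDiscriminantInt) →
    (∃ (ℓ₁ ℓ₂ : ℕ) (_ : Fact ℓ₁.Prime) (_ : Fact ℓ₂.Prime), ℓ₁ ≠ ℓ₂ ∧
      W.HasMultiplicativeReductionAtPrime ℓ₁ ∧ W.HasMultiplicativeReductionAtPrime ℓ₂) →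
    ¬ p ∣ W.tamagawaProduct → W.analyticRank = 1 →
    IsImaginaryQuadratic K → Odd (NumberField.discr K) → NumberField.discr K < -4 →
    SatisfiesHeegnerHypothesis (W.conductorNorm ℤ) K →
    (W.quadraticTwist (NumberField.discr K : ℚ)).entireLFunction 1 ≠ 0 →
    (4 * (W.conductorNorm ℤ : ℤ)) ∣ β ^ 2 - NumberField.discr K → ¬ (p : ℤ) ∣ Dt.c →
    ∀ (c : K ≃ₐ[ℚ] K), c ≠ 1 → ∀ [Module (ZMod p) (Vp W K p)]
      [∀ v : Place K, Module (ZMod p)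
        (galoisCohomology (((W.baseChange K).torsionGaloisModule ((p ^ 1 : ℕ) : ℤ)).toLocal v) 1)],
    Nonempty (KolyvaginLocalPackageP W K p ι c) := by
  intro W _ _ _ p _ K _ _ Dt β ι h5 _ hsurj _ _ _ _ hK _ hd _ _ _ _ c hc1 _ _
  have hp2 : p ≠ 2 := by omega
  haveI : NeZero (p ^ 1 : ℕ) := ⟨pow_ne_zero 1 (Fact.out : p.Prime).ne_zero⟩
  haveI : ∀ v : Place K, CompactSpace (absoluteGaloisGroup (Place.Completion v)) := fun v ↦
    absoluteGaloisGroup_compactSpace _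
  haveI : Finite (geomTorsion (W.baseChange K) ((p ^ 1 : ℕ) : ℤ)) := finite_geomTorsion_of_neZero (W.baseChange K) (p ^ 1)
  exact nonempty_kolyvaginLocalPackageP W K p ι c hK hp2 hd hsurj hc1

end Summit.BirchSwinnertonDyer.BirchSwinnertonDyer.Cruxes.KolyvaginPrimitiveAdditive.Birth

end
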